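import Literature.NumberTheory.Automorphic.UnipotentSolvable
import Literature.NumberTheory.Automorphic.ZariskiCones
import HarnessLib

/-!
# The representation of a line stabiliser on the quotient `kⁿ / k v` (coordinates)

Trunk T-AUTOMORPHIC (G25 AutomorphicL); infrastructure for the conjugacy of Borel subgroups
(Springer, *Linear Algebraic Groups*, 2nd ed., 6.2.7 (iii); `BorelConjugacy.lean`), in the
concrete `k`-points vocabulary of `LinearAlgebraicGroups.lean` (subgroups of `GL n k`, algebraic
homomorphisms `MonoidHom.IsAlgebraicGL`). For a vector `v ∈ kⁿ` normalised by `v i₀ = 1` the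
quotient `kⁿ / k v` is identified with `k^{n-1} = {a // a ≠ i₀} → k` through
`x ↦ (x_a - x_{i₀} v_a)_{a ≠ i₀}` (`lineQuotVec`), and a matrix `M` with `M v ∈ k v` acts on it
by the matrix `lineQuotMat i₀ v M = (M_{ab} - v_a M_{i₀ b})_{a, b ≠ i₀}`
(`lineQuotMat_mulVec_lineQuotVec`). Proved here:

* `lineQuotMat_one`, `lineQuotMat_mul` — multiplicativity on the stabiliser of the line `k v`,
  whence the homomorphism `lineQuotRep : S →* GL {a // a ≠ i₀} k` for every subgroup `S` of the
  line stabiliser, which is **algebraic** (`isAlgebraicGL_lineQuotRep`: entries are linear in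
  the entries of `g`, and `det⁻¹` is the determinant of the quotient matrix of `g⁻¹`);
* `lineQuotKer i₀ v` — the subgroup of `g ∈ GL n k` with `g v ∈ k v` acting trivially on
  `kⁿ / k v`; it is **solvable** (`isSolvable_lineQuotKer`): its elements fixing `v` form a
  unipotent subgroup `lineQuotFix i₀ v` (`(g - 1)² = 0`), solvable by Kolchin
  (`IsUnipotentSubgroup.isSolvable`, Springer 2.4.13), which contains all commutators;
  `isSolvable_ker_lineQuotRep`.

These give the induction step "pass from `G` to the image of the stabiliser `P` of a closed orbit
`G · [v] ⊆ ℙ(kⁿ)` in `GL(kⁿ / k v)`" of `BorelConjugacy.lean` (Springer 6.2.7, proof, by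
induction on `dim G`; here by induction on `n`).

## References

* [SpringerLAG1998] T. A. Springer, *Linear Algebraic Groups*, 2nd ed., Progress in Mathematics 9,
  Birkhäuser (1998): 2.2.5, 2.4.13, 6.2.7.
-/

open Matrix MvPolynomial

namespace Literature.NumberTheory.Automorphic

variable {k : Type*} [Field k] {ι : Type*} [Fintype ι] [DecidableEq ι]

/-! ### Reduction of vectors and matrices modulo the line `k v` -/

section Reduction

variable (i₀ : ι) (v : ι → k)

/-- `x - x_{i₀} v`: the representative of `x mod k v` with vanishing `i₀`-coordinate
(when `v i₀ = 1`). [folklore] -/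
def lineRedVec (x : ι → k) : ι → k := x - x i₀ • v

/-- `M - v ⊗ M_{i₀ •}`: the matrix with `lineRedVec (M x) = lineRedMat M (lineRedVec x)` whenever
`M v ∈ k v` (`lineRedMat_mulVec_lineRedVec`). [folklore] -/
def lineRedMat (M : Matrix ι ι k) : Matrix ι ι k := M - vecMulVec v fun b => M i₀ b

/-- The coordinates of `x mod k v` in `k^{n-1} = {a // a ≠ i₀} → k`. [folklore] -/
def lineQuotVec (x : ι → k) : {a // a ≠ i₀} → k := fun a => lineRedVec i₀ v x a

/-- The matrix of the action of `M` (with `M v ∈ k v`) on `kⁿ / k v ≅ k^{n-1}`. [folklore] -/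
def lineQuotMat (M : Matrix ι ι k) : Matrix {a // a ≠ i₀} {a // a ≠ i₀} k :=
  (lineRedMat i₀ v M).submatrix Subtype.val Subtype.val

/-- The lift `k^{n-1} → kⁿ` extending by `0` at `i₀`, a section of `lineQuotVec`
(`lineQuotVec_lineLiftVec`). [folklore] -/
def lineLiftVec (y : {a // a ≠ i₀} → k) : ι → k := fun a => if h : a = i₀ then 0 else y ⟨a, h⟩

variable {i₀ v}

omit [Fintype ι] [DecidableEq ι] in
/-- `lineRedVec` is additive-linear: it commutes with subtraction. [folklore] -/
lemma lineRedVec_sub (x y : ι → k) :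
    lineRedVec i₀ v (x - y) = lineRedVec i₀ v x - lineRedVec i₀ v y := by
  simp only [lineRedVec, Pi.sub_apply, sub_smul]
  abel

omit [Fintype ι] [DecidableEq ι] in
/-- The `i₀`-coordinate of `lineRedVec x` vanishes (for `v i₀ = 1`). [folklore] -/
lemma lineRedVec_apply_self (hv : v i₀ = 1) (x : ι → k) : lineRedVec i₀ v x i₀ = 0 := by
  simp [lineRedVec, hv]

omit [Fintype ι] [DecidableEq ι] in
/-- The `i₀`-row of `lineRedMat M` vanishes (for `v i₀ = 1`). [folklore] -/
lemma lineRedMat_apply_self (hv : v i₀ = 1) (M : Matrix ι ι k) (b : ι) :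
    lineRedMat i₀ v M i₀ b = 0 := by
  simp [lineRedMat, vecMulVec_apply, hv]

omit [Fintype ι] [DecidableEq ι] in
/-- A vector with vanishing reduction is a multiple of `v`. [folklore] -/
lemma eq_smul_of_lineRedVec_eq_zero (hv : v i₀ = 1) {x : ι → k}
    (hx : ∀ a, a ≠ i₀ → lineRedVec i₀ v x a = 0) : x = x i₀ • v := by
  funext a
  by_cases ha : a = i₀
  · subst ha
    simp [hv]
  · have h := hx a ha
    rw [lineRedVec, Pi.sub_apply, sub_eq_zero] at h
    exact h

omit [DecidableEq ι] in
/-- **The reduction intertwines `M` and `lineRedMat M` when `M v ∈ k v`.** [folklore] -/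
theorem lineRedMat_mulVec_lineRedVec (hv : v i₀ = 1) {M : Matrix ι ι k} {c : k}
    (hM : M *ᵥ v = c • v) (x : ι → k) :
    lineRedMat i₀ v M *ᵥ lineRedVec i₀ v x = lineRedVec i₀ v (M *ᵥ x) := by
  have hrow : (fun b => M i₀ b) ⬝ᵥ v = c := by
    have h := congrFun hM i₀
    simp only [mulVec, Pi.smul_apply, smul_eq_mul, hv, mul_one] at h
    exact h
  have hrowx : (fun b => M i₀ b) ⬝ᵥ x = (M *ᵥ x) i₀ := rfl
  simp only [lineRedMat, lineRedVec, sub_mulVec, mulVec_sub, mulVec_smul, vecMulVec_mulVec,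
    op_smul_eq_smul, hM, hrow, hrowx, sub_self, smul_zero, sub_zero]

/-- Sums over `{a // a ≠ i₀}` are sums over `ι` minus the `i₀`-term. [folklore] -/
lemma sum_subtype_ne_eq (F : ι → k) : ∑ b : {a // a ≠ i₀}, F b = ∑ b, F b - F i₀ := by
  rw [← Finset.sum_erase_eq_sub (Finset.mem_univ i₀),
    Finset.sum_subtype (Finset.univ.erase i₀) (p := fun a => a ≠ i₀)]
  intro x
  simp

/-- **`lineQuotMat M` is the action of `M` on `kⁿ / k v`** (in the coordinates `lineQuotVec`),
for `M v ∈ k v` and `v i₀ = 1`. [folklore] -/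
theorem lineQuotMat_mulVec_lineQuotVec (hv : v i₀ = 1) {M : Matrix ι ι k} {c : k}
    (hM : M *ᵥ v = c • v) (x : ι → k) :
    lineQuotMat i₀ v M *ᵥ lineQuotVec i₀ v x = lineQuotVec i₀ v (M *ᵥ x) := by
  funext a
  have h := congrFun (lineRedMat_mulVec_lineRedVec hv hM x) a.1
  rw [lineQuotVec, ← h]
  simp only [mulVec, dotProduct, lineQuotMat, submatrix_apply, lineQuotVec]
  rw [sum_subtype_ne_eq (F := fun b => lineRedMat i₀ v M a.1 b * lineRedVec i₀ v x b),
    lineRedVec_apply_self hv, mul_zero, sub_zero]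

omit [Fintype ι] in
/-- `lineLiftVec y` has vanishing `i₀`-coordinate. [folklore] -/
lemma lineLiftVec_apply_self (y : {a // a ≠ i₀} → k) : lineLiftVec i₀ y i₀ = 0 := by
  simp [lineLiftVec]

omit [Fintype ι] in
/-- `lineQuotVec ∘ lineLiftVec = id`: the coordinates on `kⁿ / k v` are surjective. [folklore] -/
lemma lineQuotVec_lineLiftVec (y : {a // a ≠ i₀} → k) : lineQuotVec i₀ v (lineLiftVec i₀ y) = y := by
  funext a
  simp [lineQuotVec, lineRedVec, lineLiftVec, a.2]

omit [Fintype ι] in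
/-- `lineQuotVec` is surjective. [folklore] -/
lemma lineQuotVec_surjective : Function.Surjective (lineQuotVec i₀ v) :=
  fun y => ⟨_, lineQuotVec_lineLiftVec y⟩

omit [Fintype ι] in
/-- The quotient matrix of `1` is `1`. [folklore] -/
theorem lineQuotMat_one : lineQuotMat i₀ v (1 : Matrix ι ι k) = 1 := by
  ext a b
  simp only [lineQuotMat, submatrix_apply, lineRedMat, Matrix.sub_apply, vecMulVec_apply]
  rw [one_apply_ne' b.2, mul_zero, sub_zero]
  by_cases hab : a = b
  · subst hab
    simp
  · rw [one_apply_ne hab, one_apply_ne fun h => hab (Subtype.ext h)]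

/-- **Multiplicativity of `lineQuotMat` on the stabiliser of the line `k v`.** [folklore] -/
theorem lineQuotMat_mul (hv : v i₀ = 1) {M N : Matrix ι ι k} {c d : k} (hM : M *ᵥ v = c • v)
    (hN : N *ᵥ v = d • v) :
    lineQuotMat i₀ v (M * N) = lineQuotMat i₀ v M * lineQuotMat i₀ v N := by
  have hMN : (M * N) *ᵥ v = (d * c) • v := by
    rw [← mulVec_mulVec, hN, mulVec_smul, hM, smul_smul]
  apply mulVec_injective
  funext y
  obtain ⟨x, rfl⟩ := lineQuotVec_surjective (i₀ := i₀) (v := v) y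
  rw [lineQuotMat_mulVec_lineQuotVec hv hMN, ← mulVec_mulVec, ← mulVec_mulVec,
    lineQuotMat_mulVec_lineQuotVec hv hN, lineQuotMat_mulVec_lineQuotVec hv hM]

omit [Fintype ι] [DecidableEq ι] in
/-- A vector with vanishing quotient coordinates is a multiple of `v`. [folklore] -/
lemma eq_smul_of_lineQuotVec_eq_zero (hv : v i₀ = 1) {x : ι → k} (hx : lineQuotVec i₀ v x = 0) :
    x = x i₀ • v :=
  eq_smul_of_lineRedVec_eq_zero hv fun a ha => congrFun hx ⟨a, ha⟩

omit [Fintype ι] [DecidableEq ι] in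
/-- `lineQuotVec` commutes with subtraction. [folklore] -/
lemma lineQuotVec_sub (x y : ι → k) :
    lineQuotVec i₀ v (x - y) = lineQuotVec i₀ v x - lineQuotVec i₀ v y := by
  funext a
  simp [lineQuotVec, lineRedVec_sub]

end Reduction

/-! ### The quotient representation of a subgroup of the line stabiliser -/

section Rep

variable {i₀ : ι} {v : ι → k} {S : Subgroup (GL ι k)}

/-- The scalar by which an element of the line stabiliser acts on `v` is a unit. [folklore] -/
lemma smul_ne_zero_of_mulVec_eq (hv : v i₀ = 1) {g : GL ι k} {c : k}
    (hc : (g : Matrix ι ι k) *ᵥ v = c • v) : c ≠ 0 := by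
  rintro rfl
  rw [zero_smul] at hc
  have h : v = 0 := by
    have := congrArg (fun w => ((g⁻¹ : GL ι k) : Matrix ι ι k) *ᵥ w) hc
    simpa only [mulVec_mulVec, ← Units.val_mul, inv_mul_cancel, Units.val_one, one_mulVec,
      mulVec_zero] using this
  have := congrFun h i₀
  rw [hv] at this
  exact one_ne_zero this

/-- The inverse of an element of the line stabiliser acts on `v` by the inverse scalar.
[folklore] -/
lemma inv_mulVec_eq (hv : v i₀ = 1) {g : GL ι k} {c : k} (hc : (g : Matrix ι ι k) *ᵥ v = c • v) :
    ((g⁻¹ : GL ι k) : Matrix ι ι k) *ᵥ v = c⁻¹ • v := by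
  have hc0 := smul_ne_zero_of_mulVec_eq hv hc
  have h := congrArg (fun w => c⁻¹ • (((g⁻¹ : GL ι k) : Matrix ι ι k) *ᵥ w)) hc
  simp only [mulVec_mulVec, ← Units.val_mul, inv_mul_cancel, Units.val_one, one_mulVec,
    mulVec_smul, smul_smul, inv_mul_cancel₀ hc0, one_smul] at h
  exact h.symm

variable (i₀ v S) in
/-- **The quotient representation** `S → GL(kⁿ / k v) = GL {a // a ≠ i₀} k` of a subgroup `S`
of the stabiliser of the line `k v` (`v i₀ = 1`), `g ↦ lineQuotMat i₀ v g`. [folklore] -/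
noncomputable def lineQuotRep (hv : v i₀ = 1)
    (hS : ∀ g ∈ S, ∃ c : k, (g : Matrix ι ι k) *ᵥ v = c • v) : ↥S →* GL {a // a ≠ i₀} k :=
  MonoidHom.toHomUnits
    { toFun := fun g => lineQuotMat i₀ v ((g : GL ι k) : Matrix ι ι k)
      map_one' := by simp [lineQuotMat_one]
      map_mul' := fun g h => by
        obtain ⟨c, hc⟩ := hS g g.2
        obtain ⟨d, hd⟩ := hS h h.2
        simpa using lineQuotMat_mul hv hc hd }

/-- The matrix of `lineQuotRep g` is `lineQuotMat i₀ v g`. [folklore] -/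
@[simp] lemma coe_lineQuotRep (hv : v i₀ = 1)
    (hS : ∀ g ∈ S, ∃ c : k, (g : Matrix ι ι k) *ᵥ v = c • v) (g : ↥S) :
    ((lineQuotRep i₀ v S hv hS g : GL {a // a ≠ i₀} k) : Matrix {a // a ≠ i₀} {a // a ≠ i₀} k) =
      lineQuotMat i₀ v ((g : GL ι k) : Matrix ι ι k) := rfl

/-- The generic quotient matrix: entries `X_{a b} - v_a X_{i₀ b}` (`a, b ≠ i₀`). [folklore] -/
noncomputable def lineQuotMatPoly (i₀ : ι) (v : ι → k) :
    Matrix {a // a ≠ i₀} {a // a ≠ i₀} (MvPolynomial (GLCoord ι) k) :=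
  Matrix.of fun a b => X (Sum.inl (a.1, b.1)) - C (v a.1) * X (Sum.inl (i₀, b.1))

/-- Evaluating the generic quotient matrix at the coordinates of `g` gives `lineQuotMat i₀ v g`.
[folklore] -/
lemma eval_mapMatrix_lineQuotMatPoly (g : GL ι k) :
    (MvPolynomial.eval (glCoordFun g)).mapMatrix (lineQuotMatPoly i₀ v) =
      lineQuotMat i₀ v (g : Matrix ι ι k) := by
  ext a b
  simp [lineQuotMatPoly, lineQuotMat, lineRedMat, vecMulVec_apply, mul_comm]

/-- **The quotient representation is algebraic** (Springer 2.2.5 applies to it): the entries of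
`lineQuotRep g` are linear in the entries of `g`, and `det (lineQuotRep g)⁻¹ = det (lineQuotMat g⁻¹)`
is a polynomial in the entries of `g⁻¹`, which are polynomials in the coordinates of `g`
(`invPolyGL`). [folklore] -/
theorem isAlgebraicGL_lineQuotRep (hv : v i₀ = 1)
    (hS : ∀ g ∈ S, ∃ c : k, (g : Matrix ι ι k) *ᵥ v = c • v) :
    MonoidHom.IsAlgebraicGL (lineQuotRep i₀ v S hv hS) := by
  classical
  refine ⟨Sum.elim (fun ab => lineQuotMatPoly i₀ v ab.1 ab.2)
    (fun _ => MvPolynomial.bind₁ invPolyGL (lineQuotMatPoly i₀ v).det), fun g c => ?_⟩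
  rcases c with ⟨a, b⟩ | u
  · have h := congrFun (congrFun (eval_mapMatrix_lineQuotMatPoly (i₀ := i₀) (v := v)
      (g : GL ι k)) a) b
    rw [RingHom.mapMatrix_apply, Matrix.map_apply] at h
    rw [glCoordFun_inl, coe_lineQuotRep, Sum.elim_inl, h]
  · rw [glCoordFun_inr, Sum.elim_inr, eval_bind₁]
    have hfun : (fun i => MvPolynomial.eval (glCoordFun (g : GL ι k)) (invPolyGL i)) =
        glCoordFun ((g : GL ι k)⁻¹) := funext fun i => eval_invPolyGL _ i
    rw [hfun, RingHom.map_det, eval_mapMatrix_lineQuotMatPoly]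
    have hinv : lineQuotMat i₀ v (((g : GL ι k)⁻¹ : GL ι k) : Matrix ι ι k) =
        (((lineQuotRep i₀ v S hv hS g)⁻¹ : GL {a // a ≠ i₀} k) :
          Matrix {a // a ≠ i₀} {a // a ≠ i₀} k) := by
      rw [← map_inv, coe_lineQuotRep]
      rfl
    rw [hinv, Matrix.coe_units_inv, Matrix.det_nonsing_inv, Ring.inverse_eq_inv']

end Rep

/-! ### The kernel of the quotient representation is solvable -/

section Kernel

variable (i₀ : ι) (v : ι → k)

/-- The elements of `GL n k` stabilising the line `k v` and acting trivially on `kⁿ / k v`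
(the kernel of the quotient representation on the full line stabiliser). [folklore] -/
def lineQuotKer (hv : v i₀ = 1) : Subgroup (GL ι k) where
  carrier := {g | (∃ c : k, (g : Matrix ι ι k) *ᵥ v = c • v) ∧
    lineQuotMat i₀ v (g : Matrix ι ι k) = 1}
  one_mem' := ⟨⟨1, by simp⟩, by simp [lineQuotMat_one]⟩
  mul_mem' := by
    rintro g h ⟨⟨c, hc⟩, hg⟩ ⟨⟨d, hd⟩, hh⟩
    refine ⟨⟨d * c, ?_⟩, ?_⟩
    · rw [Units.val_mul, ← mulVec_mulVec, hd, mulVec_smul, hc, smul_smul]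
    · rw [Units.val_mul, lineQuotMat_mul hv hc hd, hg, hh, one_mul]
  inv_mem' := by
    rintro g ⟨⟨c, hc⟩, hg⟩
    refine ⟨⟨c⁻¹, inv_mulVec_eq hv hc⟩, ?_⟩
    have h := lineQuotMat_mul hv hc (inv_mulVec_eq hv hc)
    rw [← Units.val_mul, mul_inv_cancel, Units.val_one, lineQuotMat_one, hg, one_mul] at h
    exact h.symm

/-- The elements of `lineQuotKer` fixing `v` itself. [folklore] -/
def lineQuotFix (hv : v i₀ = 1) : Subgroup (GL ι k) where
  carrier := {g | g ∈ lineQuotKer i₀ v hv ∧ (g : Matrix ι ι k) *ᵥ v = v}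
  one_mem' := ⟨(lineQuotKer i₀ v hv).one_mem, by simp⟩
  mul_mem' := by
    rintro g h ⟨hg, hgv⟩ ⟨hh, hhv⟩
    refine ⟨(lineQuotKer i₀ v hv).mul_mem hg hh, ?_⟩
    rw [Units.val_mul, ← mulVec_mulVec, hhv, hgv]
  inv_mem' := by
    rintro g ⟨hg, hgv⟩
    refine ⟨(lineQuotKer i₀ v hv).inv_mem hg, ?_⟩
    have h := inv_mulVec_eq hv (c := 1) (g := g) (by rw [hgv, one_smul])
    rwa [inv_one, one_smul] at h

variable {i₀ v}

/-- Membership in `lineQuotKer`. [folklore] -/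
lemma mem_lineQuotKer_iff (hv : v i₀ = 1) {g : GL ι k} :
    g ∈ lineQuotKer i₀ v hv ↔ (∃ c : k, (g : Matrix ι ι k) *ᵥ v = c • v) ∧
      lineQuotMat i₀ v (g : Matrix ι ι k) = 1 := Iff.rfl

/-- Membership in `lineQuotFix`. [folklore] -/
lemma mem_lineQuotFix_iff (hv : v i₀ = 1) {g : GL ι k} :
    g ∈ lineQuotFix i₀ v hv ↔ g ∈ lineQuotKer i₀ v hv ∧ (g : Matrix ι ι k) *ᵥ v = v := Iff.rfl

/-- `lineQuotFix ≤ lineQuotKer`. [folklore] -/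
lemma lineQuotFix_le (hv : v i₀ = 1) : lineQuotFix i₀ v hv ≤ lineQuotKer i₀ v hv :=
  fun _ h => h.1

/-- An element acting trivially on `k v` and on `kⁿ / k v` satisfies `(g - 1)² = 0`, so
**`lineQuotFix` is a unipotent subgroup**. [folklore] -/
theorem isUnipotentSubgroup_lineQuotFix (hv : v i₀ = 1) :
    IsUnipotentSubgroup (lineQuotFix i₀ v hv) := by
  rintro g ⟨⟨⟨c, hc⟩, hg1⟩, hgv⟩
  -- `(g - 1) x ∈ k v` for all `x`
  have hred : ∀ x : ι → k, ((g : Matrix ι ι k) - 1) *ᵥ x =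
      ((((g : Matrix ι ι k) - 1) *ᵥ x) i₀) • v := by
    intro x
    apply eq_smul_of_lineQuotVec_eq_zero hv
    rw [sub_mulVec, one_mulVec, lineQuotVec_sub, ← lineQuotMat_mulVec_lineQuotVec hv hc, hg1,
      one_mulVec, sub_self]
  have hv0 : ((g : Matrix ι ι k) - 1) *ᵥ v = 0 := by rw [sub_mulVec, one_mulVec, hgv, sub_self]
  refine ⟨2, ?_⟩
  apply mulVec_injective
  funext x
  rw [pow_two, ← mulVec_mulVec, hred x, mulVec_smul, hv0, smul_zero, zero_mulVec]

/-- Commutators of elements of `lineQuotKer` fix `v`. [folklore] -/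
lemma commutatorElement_mem_lineQuotFix (hv : v i₀ = 1) {g h : GL ι k}
    (hg : g ∈ lineQuotKer i₀ v hv) (hh : h ∈ lineQuotKer i₀ v hv) :
    g * h * g⁻¹ * h⁻¹ ∈ lineQuotFix i₀ v hv := by
  refine ⟨(lineQuotKer i₀ v hv).mul_mem ((lineQuotKer i₀ v hv).mul_mem
    ((lineQuotKer i₀ v hv).mul_mem hg hh) ((lineQuotKer i₀ v hv).inv_mem hg))
    ((lineQuotKer i₀ v hv).inv_mem hh), ?_⟩
  obtain ⟨⟨c, hc⟩, -⟩ := hg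
  obtain ⟨⟨d, hd⟩, -⟩ := hh
  have hc0 := smul_ne_zero_of_mulVec_eq hv hc
  have hd0 := smul_ne_zero_of_mulVec_eq hv hd
  rw [Units.val_mul, Units.val_mul, Units.val_mul, ← mulVec_mulVec, inv_mulVec_eq hv hd,
    mulVec_smul, ← mulVec_mulVec, inv_mulVec_eq hv hc, mulVec_smul, ← mulVec_mulVec, hd,
    mulVec_smul, hc, smul_smul, smul_smul, smul_smul,
    show d⁻¹ * c⁻¹ * d * c = 1 by field_simp, one_smul]

/-- **`lineQuotKer` is solvable**: its commutator subgroup lies in the unipotent, hence solvable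
(`IsUnipotentSubgroup.isSolvable`, Springer 2.4.13), subgroup `lineQuotFix`, and the quotient by
the commutator subgroup is commutative. [folklore] -/
theorem isSolvable_lineQuotKer [IsAlgClosed k] (hv : v i₀ = 1) :
    IsSolvable ↥(lineQuotKer i₀ v hv) := by
  set K := lineQuotKer i₀ v hv
  set A := lineQuotFix i₀ v hv
  have hA : IsSolvable ↥A := (isUnipotentSubgroup_lineQuotFix hv).isSolvable
  have hAK : A ≤ K := lineQuotFix_le hv
  haveI : IsSolvable ↥(A.subgroupOf K) :=
    solvable_of_solvable_injective (f := (Subgroup.subgroupOfEquivOfLe hAK).toMonoidHom)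
      fun x y hxy => (Subgroup.subgroupOfEquivOfLe hAK).injective hxy
  refine solvable_of_ker_le_range (A.subgroupOf K).subtype (Abelianization.of (G := ↥K)) ?_
  rw [Abelianization.ker_of, Subgroup.range_subtype, commutator_def, Subgroup.commutator_le]
  rintro g - h -
  rw [Subgroup.mem_subgroupOf]
  have := commutatorElement_mem_lineQuotFix hv g.2 h.2
  simpa [commutatorElement_def] using this

/-- **The kernel of the quotient representation of `S` is solvable** (it embeds in
`lineQuotKer`). [folklore] -/
theorem isSolvable_ker_lineQuotRep [IsAlgClosed k] {S : Subgroup (GL ι k)} (hv : v i₀ = 1)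
    (hS : ∀ g ∈ S, ∃ c : k, (g : Matrix ι ι k) *ᵥ v = c • v) :
    IsSolvable ↥(lineQuotRep i₀ v S hv hS).ker := by
  haveI := isSolvable_lineQuotKer (k := k) hv
  let f : ↥(lineQuotRep i₀ v S hv hS).ker →* ↥(lineQuotKer i₀ v hv) :=
    { toFun := fun g => ⟨((g : ↥S) : GL ι k), hS _ (g : ↥S).2, by
        have h := g.2
        rw [MonoidHom.mem_ker] at h
        have h' := congrArg (fun u : GL {a // a ≠ i₀} k => (u : Matrix {a // a ≠ i₀} {a // a ≠ i₀} k)) h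
        simpa using h'⟩
      map_one' := rfl
      map_mul' := fun _ _ => rfl }
  refine solvable_of_solvable_injective (f := f) fun x y hxy => ?_
  exact Subtype.ext (Subtype.ext (congrArg (fun z : ↥(lineQuotKer i₀ v hv) => (z : GL ι k)) hxy))

end Kernel

end Literature.NumberTheory.Automorphic
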